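import Mathlib.CategoryTheory.Galois.Equivalence
import Mathlib.CategoryTheory.Comma.Over.Pullback
import Mathlib.CategoryTheory.Limits.Preserves.Finite
import Mathlib.CategoryTheory.Limits.Preserves.Shapes.BinaryProducts
import Mathlib.CategoryTheory.Adjunction.Limits
import Literature.AnabelianGeometry.Anabelioids.InductionStar
import Literature.AnabelianGeometry.Anabelioids.BasicProofs
import HarnessLib

/-!
# Slices of a connected anabelioid: `Over.star P` is exact ([SemiAnbd] Def. 2.2 (i), brick B4(a))

Mochizuki, *Semi-graphs of anabelioids*, Publ. RIMS **42** (2006), §2 p. 23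
[cite: MochizukiSemiAnbd2006, Def. 2.2(i) p.23]; *The geometry of anabelioids*, Publ. RIMS **40**
(2004), §1.2 p. 16 and Remark 1.2.2.1 p. 17 [cite: MochizukiGeoAn2004, Rem. 1.2.2.1 p.17]: the finite
étale morphism `X_S → X` of a connected anabelioid has pull-back functor `i_S^* = Over.star S`,
"taking the product with `S`"; for the covering `𝒢' → 𝒢` attached to an object of `B(𝒢)` the
vertex components `φ_{v'} : (𝒢_v)_P → 𝒢_v` are of this form.  A morphism of anabelioids being an
EXACT functor ([GeoAn] Def. 1.1.2 (i)), the assembly of `exists_finiteEtaleCovering` needs: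

* `preservesFiniteColimits_overStar` — for a connected object `P` of a Galois category,
  `Over.star P` preserves finite colimits (finite limits are free: `Over.star P` is right adjoint
  to the forgetful functor, Mathlib).

Proof (the `B(U)` picture of Remark 1.2.2.1): for `B(G)` and the coset object `G/U` (`U` open of
finite index), `Over.star (G/U)` followed by the fibre equivalence `Over (G/U) ≌ B(U)` (abc-iut-L3-t12,
`Induction.starFiberIso`) is restriction `B(G) → B(U)`, which preserves finite colimits (continuity
is closed under finite colimits, abc-iut-L3-t5 `BasicProofs`); the general case is transported along
`C ≌ B(Aut F)`, `P ↦ Aut F / Stab(x)` using the comparison `Over.star P ⋙ Over.post e ≅ e ⋙ Over.star (e P)`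
(`nonempty_starPostIso`) and `Over.star Y ⋙ Over.map i ≅ Over.star Y'` for an isomorphism `i`.
Proof-only (isomorphisms are asserted to exist).  The companion exactness of `Over.post` and of
`Over.pullback` along a monomorphism is abc-iut-L3-t6's `OverPullbackExact`.
-/

namespace Literature.AnabelianGeometry.Anabelioids

open CategoryTheory CategoryTheory.Limits CategoryTheory.PreGaloisCategory Topology
open Literature.AlgebraicGeometry.Frobenioids (BCat)
open scoped FintypeCatDiscrete Pointwise

universe w w' v₁ v₂ u₁ u₂ u

/-! ### Two comparison isomorphisms for `Over.star` -/

section Comparison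

variable {C : Type u₁} [Category.{v₁} C] {D : Type u₂} [Category.{v₂} D]
  [HasBinaryProducts C] [HasBinaryProducts D]

set_option backward.isDefEq.respectTransparency false in
/-- For `F` preserving binary products, lifting to the slice over `P` and then applying `F` is
applying `F` and then lifting to the slice over `F P`: `F (P × X) ≅ F P × F X` over `F P`.
[cite: MochizukiSemiAnbd2006, Def. 2.2(i) p.23] -/
theorem nonempty_starPostIso (F : C ⥤ D) [PreservesLimitsOfShape (Discrete WalkingPair) F] (P : C) :
    Nonempty (Over.star P ⋙ Over.post F ≅ F ⋙ Over.star (F.obj P)) :=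
  ⟨NatIso.ofComponents
    (fun X => Over.isoMk (PreservesLimitPair.iso F P X) (by
      rw [PreservesLimitPair.iso_hom]
      change prodComparison F P X ≫ (prod.lift prod.fst (𝟙 _) ≫ prod.fst) =
        F.map (prod.lift prod.fst (𝟙 _) ≫ prod.fst)
      rw [prod.lift_fst, prod.lift_fst, prodComparison_fst]))
    (fun {X Y} g => by
      ext
      simp only [Functor.comp_map, Over.comp_left, Over.post_map,
        Over.homMk_left, Over.isoMk_hom_left, Over.star_map_left, PreservesLimitPair.iso_hom]
      exact (prodComparison_natural F (𝟙 P) g).trans (by rw [F.map_id]))⟩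

set_option backward.isDefEq.respectTransparency false in
/-- Lifting to the slice over `Y` and composing with an isomorphism `i : Y ≅ Y'` is lifting to the
slice over `Y'`: `(Y × X → Y ⥲ Y') ≅ (Y' × X → Y')`. [cite: MochizukiSemiAnbd2006, Def. 2.2(i) p.23] -/
theorem nonempty_starMapIso {Y Y' : C} (i : Y ≅ Y') :
    Nonempty (Over.star Y ⋙ Over.map i.hom ≅ Over.star Y') :=
  ⟨NatIso.ofComponents
    (fun X => Over.isoMk (prod.mapIso i (Iso.refl X)) (by
      change prod.map i.hom (𝟙 X) ≫ (prod.lift prod.fst (𝟙 _) ≫ prod.fst) =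
        (prod.lift prod.fst (𝟙 _) ≫ prod.fst) ≫ i.hom
      rw [prod.lift_fst, prod.lift_fst, prod.map_fst]))
    (fun {X X'} g => by
      ext
      change prod.map (𝟙 Y) g ≫ prod.map i.hom (𝟙 X') = prod.map i.hom (𝟙 X) ≫ prod.map (𝟙 Y') g
      rw [prod.map_map, prod.map_map, Category.id_comp, Category.comp_id, Category.id_comp,
        Category.comp_id])⟩

end Comparison

/-! ### `B(G)`: `Over.star (G/U)` is right exact -/

section BCat

variable {G : Type u} [Group G] [TopologicalSpace G] [IsTopologicalGroup G]

/-- Restriction `B(G) → B(U)` to a subgroup preserves finite colimits (colimits of continuous finite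
`G`-sets are computed on underlying sets). [cite: MochizukiGeoAn2004, Rem. 1.2.2.1 p.17] -/
theorem preservesColimitsOfShape_res_inclHom (U : Subgroup G) (J : Type) [SmallCategory J]
    [FinCategory J] :
    PreservesColimitsOfShape J (ContAction.res FintypeCat.{u} (Induction.inclHom U)) := by
  haveI := isClosedUnderColimitsOfShape_isContinuous (G := G) J
  haveI := isClosedUnderColimitsOfShape_isContinuous (G := U) J
  haveI : PreservesColimitsOfShape J (Action.res FintypeCat.{u} (Induction.inclHom U : U →* G)) :=
    Action.preservesColimitsOfShape_of_preserves _
      (inferInstanceAs (PreservesColimitsOfShape J (Action.forget FintypeCat.{u} G)))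
  haveI : PreservesColimitsOfShape J (ContAction.res FintypeCat.{u} (Induction.inclHom U) ⋙
      ObjectProperty.ι (Action.IsContinuous (V := FintypeCat.{u}) (G := U))) :=
    inferInstanceAs (PreservesColimitsOfShape J
      (ObjectProperty.ι (Action.IsContinuous (V := FintypeCat.{u}) (G := G)) ⋙
        Action.res FintypeCat.{u} (Induction.inclHom U : U →* G)))
  exact preservesColimitsOfShape_of_reflects_of_preserves
    (ContAction.res FintypeCat.{u} (Induction.inclHom U))
    (ObjectProperty.ι (Action.IsContinuous (V := FintypeCat.{u}) (G := U)))

/-- For an open subgroup `U` of finite index, `Over.star (G/U) : B(G) ⥤ B(G)_{G/U}` preserves finite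
colimits: followed by the fibre equivalence `B(G)_{G/U} ≌ B(U)` it is restriction to `U`
([GeoAn] Rem. 1.2.2.1). [cite: MochizukiGeoAn2004, Rem. 1.2.2.1 p.17] -/
theorem preservesFiniteColimits_overStar_quotObj [CompactSpace G] [HasBinaryProducts (BCat G)]
    (U : Subgroup G) (hU : IsOpen (U : Set G)) [Finite (G ⧸ U)] :
    PreservesFiniteColimits (Over.star (Induction.quotObj U hU)) := by
  refine ⟨fun J _ _ => ?_⟩
  haveI := preservesColimitsOfShape_res_inclHom U J
  haveI : PreservesColimitsOfShape J (Over.star (Induction.quotObj U hU) ⋙ Induction.fiber U hU) :=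
    preservesColimitsOfShape_of_natIso (Induction.starFiberIso U hU).symm
  exact preservesColimitsOfShape_of_reflects_of_preserves
    (Over.star (Induction.quotObj U hU)) (Induction.fiber U hU)

end BCat

/-! ### The general case -/

/-- **`Over.star P` is right exact for a connected object `P` of a connected anabelioid**: the
pull-back functor `X ↦ (P × X → P)` of the finite étale morphism `X_P → X` ([GeoAn] §1.2 p. 16)
preserves finite colimits.  (Transport of `preservesFiniteColimits_overStar_quotObj` along
`C ≌ B(Aut F)`, `P ≅ Aut F / Stab(x)`.) [cite: MochizukiSemiAnbd2006, Def. 2.2(i) p.23] -/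
theorem preservesFiniteColimits_overStar {C : Type u₁} [Category.{u₂} C] [GaloisCategory C]
    (P : C) [IsConnected P] : PreservesFiniteColimits (Over.star P) := by
  classical
  -- a fibre functor valued in the universe of `Aut F`
  let F : C ⥤ FintypeCat.{max u₁ u₂} :=
    GaloisCategory.getFiberFunctor C ⋙ FintypeCat.uSwitch.{u₂, max u₁ u₂}
  letI : FiberFunctor F := FiberFunctor.comp_right _
  haveI : GaloisCategory (BCat (Aut F)) := galoisCategory_bCat (Aut F)
  let e₁ : C ≌ BCat (Aut F) := (functorToContAction F).asEquivalence
  let X : BCat (Aut F) := e₁.functor.obj P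
  -- a point of the (nonempty, transitive) fibre and its open stabiliser of finite index
  obtain ⟨x⟩ := (inferInstance : Nonempty (F.obj P))
  let U : Subgroup (Aut F) := MulAction.stabilizer (Aut F) x
  have hU : IsOpen (U : Set (Aut F)) :=
    (isContinuous_iff_stabilizer_isOpen X.obj).mp X.property x
  haveI : Finite (Aut F ⧸ U) :=
    Finite.of_equiv _ (MulAction.orbitEquivQuotientStabilizer (Aut F) x)
  -- the orbit map `Aut F / U ≅ X`
  have htrans : ∀ y : F.obj P, ∃ g : Aut F, g • x = y := fun y => MulAction.exists_smul_eq (Aut F) x y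
  let θ : Aut F ⧸ U → F.obj P := fun q => Quotient.liftOn' q (fun g : Aut F => g • x) fun g g' h => by
    have h' : g⁻¹ * g' ∈ U := QuotientGroup.leftRel_apply.mp h
    have hfix : (g⁻¹ * g') • x = x := MulAction.mem_stabilizer_iff.mp h'
    rw [mul_smul, inv_smul_eq_iff] at hfix
    exact hfix.symm
  have θ_mk : ∀ g : Aut F, θ (g : Aut F ⧸ U) = g • x := fun _ => rfl
  have θ_bij : Function.Bijective θ := by
    constructor
    · intro q q' hqq'
      obtain ⟨g, rfl⟩ := QuotientGroup.mk_surjective q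
      obtain ⟨g', rfl⟩ := QuotientGroup.mk_surjective q'
      rw [θ_mk, θ_mk] at hqq'
      apply QuotientGroup.eq.mpr
      apply MulAction.mem_stabilizer_iff.mpr
      rw [mul_smul, ← hqq', inv_smul_smul]
    · intro y
      obtain ⟨g, hg⟩ := htrans y
      exact ⟨(g : Aut F ⧸ U), hg⟩
  have θ_smul : ∀ (g : Aut F) (q : Aut F ⧸ U), θ (g • q) = g • θ q := by
    intro g q
    obtain ⟨k, rfl⟩ := QuotientGroup.mk_surjective q
    rw [MulAction.Quotient.smul_coe, smul_eq_mul, θ_mk, θ_mk, mul_smul]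
  let eV : (Induction.quotObj U hU).obj.V ≅ X.obj.V :=
    FintypeCat.equivEquivIso (Equiv.ofBijective θ θ_bij)
  let i : Induction.quotObj U hU ≅ X :=
    ObjectProperty.isoMk _ (Action.mkIso eV fun g => by
      apply FintypeCat.hom_ext
      intro (q : Aut F ⧸ U)
      change θ (g • q) = g • θ q
      exact θ_smul g q)
  -- (1) `Over.star (Aut F / U)` is right exact, (2) hence so is `Over.star X`
  haveI h1 := preservesFiniteColimits_overStar_quotObj U hU
  obtain ⟨eXi⟩ := nonempty_starMapIso i
  have h2 : PreservesFiniteColimits (Over.star (Induction.quotObj U hU) ⋙ Over.map i.hom) :=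
    ⟨fun J _ _ => inferInstance⟩
  have h3 : PreservesFiniteColimits (Over.star X) :=
    @preservesFiniteColimits_of_natIso _ _ _ _ _ _ eXi h2
  -- (3) transport along `e₁`
  have h4 : PreservesFiniteColimits (e₁.functor ⋙ Over.star X) :=
    @comp_preservesFiniteColimits _ _ _ _ _ _ e₁.functor (Over.star X) inferInstance h3
  obtain ⟨eSP⟩ := nonempty_starPostIso e₁.functor P
  have h5 : PreservesFiniteColimits (Over.star P ⋙ Over.post e₁.functor) :=
    @preservesFiniteColimits_of_natIso _ _ _ _ _ _ eSP.symm h4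
  exact ⟨fun J _ _ =>
    @preservesColimitsOfShape_of_reflects_of_preserves _ _ _ _ _ _ _ _ (Over.star P)
      (Over.post e₁.functor) (h5.preservesFiniteColimits J) inferInstance⟩

/-- `Over.star P` (right adjoint to the forgetful functor) preserves finite limits — recorded next to
its right exactness for the consumers' convenience. [cite: MochizukiSemiAnbd2006, Def. 2.2(i) p.23] -/
theorem preservesFiniteLimits_overStar {C : Type u₁} [Category.{u₂} C] [HasBinaryProducts C]
    (P : C) : PreservesFiniteLimits (Over.star P) := inferInstance

end Literature.AnabelianGeometry.Anabelioids
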